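import Summits.BirchSwinnertonDyer.BirchSwinnertonDyer.Theorems.ErratumRoadFiveNonSurjCornerTwinMuOfLane
import Summits.BirchSwinnertonDyer.BirchSwinnertonDyer.Theorems.ByReductionTypeAtTwoSelmerDualInvolutionTwist
import Summits.BirchSwinnertonDyer.BirchSwinnertonDyer.Theorems.ThetaPartnerAtTwoSignedKatoUpToAtTwoIwasawaInvolutionCompat
import Literature.NumberTheory.EllipticCurves.Kato2004.DivisibilityInputsContragredient
import Literature.NumberTheory.EllipticCurves.IwasawaAlgebraInvolutionFixedPrimesProofs
import HarnessLib

/-!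
# Route `ErratumRoadFive` (rung K2), crux `NonSurjCorner` (item stmt-BirchSwinnertonDyer-19065), the twin summand: THE KATO `μ`-TRANSFER AT A
# MULTIPLICATIVE ODD PRIME WITHOUT BIG IMAGE, RE-KEYED ON THE PRINT-EXACT CONTRAGREDIENT PACKAGE XI′ (ARM-P R-48 ∕ RELAY 47–49 END re-key)
# (cell `bsd-stepL`, seat `bsd-stepL-corner-p1` g16; `--supports stmt-BirchSwinnertonDyer-19065 --as helper`)

WHY THIS FILE. This seat g6's `MultMu.mu_eq_zero_of_multFine` (module `…MuTransferMult`, p487898) — «one unit coefficient of the Néron-normalised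
Mazur–Tate–Teitelbaum function forces `μ(X(E/ℚ_∞)) = 0` at a multiplicative odd prime with `E[p]` irreducible and `ρ̄` NOT onto» — consumes the
Kato §17.13 construction fact XI `Kato2004.exists_multDivisibilityInputs_fine`, whose package is keyed on the tree's γ-convention dual
`D : W.SelmerDualData κ γ`. ARM-P's audit (r02 ADDENDUM-8, RULING (650); RELAYS 47–49 to this cell) classified XI, as typed, STRONGER-THAN-PRINT-BY-ι:
Kato's (17.13.1) is `Λ`-linear for the CONTRAGREDIENT structure `D′ : W.SelmerDualData κ γ⁻¹`; the print-exact twin XI′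
`Kato2004.exists_multDivisibilityInputs_fine_contra` landed as p604443 (guest typer defn-ty1 g18), and the plain-Selmer twist lemma T-TWIST-SEL-1
`SignedKatoOffTwo.IwasawaInvolution.exists_twist_selmerDualData_invol` as p609264 (bsd-2adic tower-1 g19). THIS FILE is the consumer re-key of the
μ-road (the V′ ∕ VI′ half of the twin road runs through bsd-2adic's `MultKatoRat` skeleton and its `SelmerDualContra` bridges p610934 — not here):
* §1 `lengthAt_X_le_of_multContra`, `exists_isEulerSystemClass_not_mem_of_multContra` — the two module-algebra ports of §1 of `…MuTransferMult`
  for `MultDivisibilityInputsContra` (fields byte-identical; proofs token-for-token).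
* §2 **`mu_eq_zero_of_multFineContra`** — SAME statement as `mu_eq_zero_of_multFine` (conclusion `D.mu = 0` for every γ-datum `D`), from XI′ + Wuthrich
  Cor. 18: twist `D ↦ D′ : SelmerDualData κ γ⁻¹` and the fine dual `Y ↦ Y′` (`exists_twist_{selmer,fineSelmer}DualData_invol`), run the g6 argument
  VERBATIM on the contragredient package (`𝐇¹` and the reduction-free core `CoreAssembly.coreOdd_anyReduction_holds` stay γ-keyed; `Sel₀[p]`
  finite ⟹ `Y′.X/(p)` finite is key-free), get `length_(p) D′.X = 0`, and come back by the twist's length clause at the ι-FIXED prime `(p)`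
  (`IwasawaAlgebra.comap_invol_eq_self_of_asIdeal_eq_augIdealP`). No functional equation is needed on the μ-road (μ is ι-invariant).
* §3 `twinMu_of_twinMuAn_contra` — the corner consumer (`Theorems.NonSurjCornerTwinMuAn → Theorems.NonSurjCornerTwinMu`) re-keyed: g6's
  `twinMu_of_twinMuAn` with `hfine ↦ hfine′`; names of the γ-keyed theorems are untouched (x11a ∕ this line re-key by swapping one token).

HONEST FRAMING: THEOREMS ONLY (no definition, no named fact, no `sorry`); CONDITIONAL on the displayed named facts XI′ (a CONSTRUCTION fact, flag
`Kato-1713-dual-action`, print-exact per ARM-P) and Wuthrich 2014 Cor. 18; nothing is asserted about any curve; items 19065 ∕ 19948 ∕ 19949 do not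
close (19949's conjunct XI stays as filed — a repaired support item is the planner's call); BSD is not advanced; T7. Credit: defn-ty1 g18 (XI′),
bsd-2adic tower-1 g19 (T-TWIST-SEL-1), bsd-wall (involution ∕ semilinear transport), b2b (fixed primes of ι), ARM-P r02 ∕ lead (the audit).
References (locators only): [cite: Kato2004Asterisque, Thm. 12.4–12.6 (pp. 221–222), (14.9.3) (p. 240), §17.3 (p. 273), §17.13 (pp. 279–280)]
[cite: Wuthrich2014, p. 391 and Cor. 18 (p. 398)] [cite: Greenberg1989, §0 pp. 101–102 (S^ι)] [cite: Washington1997, §13.2] [cite: GreenbergLNM1716, Conj. 1.11 (shape)].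
-/

set_option autoImplicit false
set_option linter.dupNamespace false

noncomputable section

open scoped Classical MatrixGroups ModularForm NumberField
open CongruenceSubgroup WeierstrassCurve Field IsDedekindDomain
open Literature.NumberTheory.GaloisRepresentations
open Literature.NumberTheory.GaloisCohomology
open Literature.NumberTheory.EllipticCurves Literature.NumberTheory.EllipticCurves.ModularForms
open Literature.NumberTheory.EllipticCurves.Kato2004 Literature.NumberTheory.EllipticCurves.Kato2004.EulerSystemValues
open Literature.NumberTheory.EllipticCurves.Rank1Residual
open Summit.BirchSwinnertonDyer.BirchSwinnertonDyer.Rank1Residual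
open Summit.BirchSwinnertonDyer.BirchSwinnertonDyer.Theorems

namespace Summit.BirchSwinnertonDyer.Rank1Residual.X11b.MultMu

open Module

/-! ### §1 Module algebra over a CONTRAGREDIENT multiplicative package (ports of §1 of `…MuTransferMult`) -/

section Algebra

variable {p : ℕ} [Fact p.Prime] {W : WeierstrassCurve ℚ} [W.IsElliptic] [W.IsGloballyMinimal]
  [ContinuousSMul ℤ_[p] (W.tateModule p)] [Module.Free ℤ_[p] (W.tateModule p)]
  [Module.Finite ℤ_[p] (W.tateModule p)] {L : PowerSeries ℚ_[p]}
  {κ : ZpExtension ℚ p} {γ : absoluteGaloisGroup ℚ}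
  {I : IwasawaH1Data W p κ γ} {D' : W.SelmerDualData κ γ⁻¹}

omit [W.IsGloballyMinimal] [Module.Free ℤ_[p] (W.tateModule p)] [Module.Finite ℤ_[p] (W.tateModule p)] in
/-- **(14.9.3)/(17.13.1) bookkeeping at a height-one prime `𝔭` for a CONTRAGREDIENT multiplicative package** (`lengthAt_X_le_of_mult` for
`MultDivisibilityInputsContra`, token-for-token): `toX ∘ loc = 0`, `s·G₁ ∈ col(loc Z)` with `s, G₁ ∉ 𝔭`, `π : X → Y` exact after `P → X` ⟹
`length X_𝔭 ≤ length Y_𝔭`. [cite: Kato2004Asterisque, (14.9.3) (p. 240), §17.13 (pp. 279–280) and Prop. 17.11 (p. 277)] -/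
theorem lengthAt_X_le_of_multContra (K : MultDivisibilityInputsContra W p L κ γ I D')
    (hloc0 : ∀ h : I.H, K.toX (K.loc h) = 0) {G₁ : IwasawaAlgebra p}
    (𝔭 : PrimeSpectrum (IwasawaAlgebra p)) (hG𝔭 : G₁ ∉ 𝔭.asIdeal)
    (himg : ∃ s : IwasawaAlgebra p, s ∉ 𝔭.asIdeal ∧ s * G₁ ∈ Submodule.map (K.col ∘ₗ K.loc) K.Z)
    {Y : Type*} [AddCommGroup Y] [Module (IwasawaAlgebra p) Y]
    (π : D'.X →ₗ[IwasawaAlgebra p] Y) (hπ : Function.Exact K.toX π) :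
    lengthAt (IwasawaAlgebra p) D'.X 𝔭 ≤ lengthAt (IwasawaAlgebra p) Y 𝔭 := by
  obtain ⟨s, hs, hsG⟩ := himg
  set LZ : Submodule (IwasawaAlgebra p) K.P := Submodule.map K.loc K.Z with hLZ
  set M : Ideal (IwasawaAlgebra p) := Submodule.map K.col LZ with hM
  have hM_eq : Submodule.map (K.col ∘ₗ K.loc) K.Z = M := by
    rw [hM, hLZ, Submodule.map_comp]
  have hsGM : s * G₁ ∈ M := hM_eq ▸ hsG
  have hnot : ¬ M ≤ 𝔭.asIdeal := fun hle ↦ by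
    rcases 𝔭.isPrime.mem_or_mem (hle hsGM) with h | h
    · exact hs h
    · exact hG𝔭 h
  have hΛM : lengthAt (IwasawaAlgebra p) (IwasawaAlgebra p ⧸ M) 𝔭 = 0 :=
    lengthAt_quotient_eq_zero_of_not_le hnot
  have hPLZ : lengthAt (IwasawaAlgebra p) (K.P ⧸ LZ) 𝔭 = 0 := by
    refine le_antisymm ?_ bot_le
    rw [← hΛM]
    refine lengthAt_le_of_injective (Submodule.mapQ LZ M K.col fun y hy ↦ ⟨y, hy, rfl⟩) ?_ 𝔭
    rw [← LinearMap.ker_eq_bot, Submodule.ker_mapQ, hM,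
      Submodule.comap_map_eq_of_injective K.col_injective, Submodule.mkQ_map_self]
  have hle : LZ ≤ LinearMap.ker K.toX := by
    rintro _ ⟨z, -, rfl⟩
    exact hloc0 z
  let f' : (K.P ⧸ LZ) →ₗ[IwasawaAlgebra p] D'.X := LZ.liftQ K.toX hle
  have hf' : Function.Exact f' π := by
    rw [LinearMap.exact_iff, Submodule.range_liftQ]
    exact LinearMap.exact_iff.mp hπ
  calc lengthAt (IwasawaAlgebra p) D'.X 𝔭
      ≤ lengthAt (IwasawaAlgebra p) (K.P ⧸ LZ) 𝔭 + lengthAt (IwasawaAlgebra p) Y 𝔭 :=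
        lengthAt_le_add_of_exact f' π hf' 𝔭
    _ = lengthAt (IwasawaAlgebra p) Y 𝔭 := by rw [hPLZ, zero_add]

omit [W.IsGloballyMinimal] in
/-- **§6 (i) with Thm. 12.6 for a CONTRAGREDIENT multiplicative package** (`exists_isEulerSystemClass_not_mem_of_mult` for
`MultDivisibilityInputsContra`, token-for-token): `G₁ ∉ (p)` and `s·G₁ ∈ col(loc Z)` with `s ∉ (p)` force a GENUINE `Λ`-adic Euler-system class in
the span of `Z` outside `p𝐇¹`. [cite: Kato2004Asterisque, Thm. 12.6 (p. 222) and §17.13 (p. 280)] -/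
theorem exists_isEulerSystemClass_not_mem_of_multContra (K : MultDivisibilityInputsContra W p L κ γ I D')
    (hZ : K.Z ≤ Submodule.span (IwasawaAlgebra p) {s : I.H | IsEulerSystemClass W p κ γ I s})
    {G₁ : IwasawaAlgebra p} (hμ : G₁ ∉ IwasawaAlgebra.augIdealP p)
    (himg : ∃ s : IwasawaAlgebra p, s ∉ IwasawaAlgebra.augIdealP p ∧
      s * G₁ ∈ Submodule.map (K.col ∘ₗ K.loc) K.Z) :
    ∃ s : I.H, IsEulerSystemClass W p κ γ I s ∧
      s ∉ IwasawaAlgebra.augIdealP p • (⊤ : Submodule (IwasawaAlgebra p) I.H) := by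
  obtain ⟨s, hs, hsG⟩ := himg
  suffices hz : ∃ z ∈ K.Z, z ∉ IwasawaAlgebra.augIdealP p • (⊤ : Submodule (IwasawaAlgebra p) I.H) by
    obtain ⟨z, hz, hzp⟩ := hz
    obtain ⟨t, ht, htp⟩ := exists_mem_not_mem_of_le_span hZ hz hzp
    exact ⟨t, ht, htp⟩
  by_contra hcon
  push Not at hcon
  have hZp : K.Z ≤ IwasawaAlgebra.augIdealP p • (⊤ : Submodule (IwasawaAlgebra p) I.H) :=
    fun z hz ↦ hcon z hz
  have hsub : Submodule.map (K.col ∘ₗ K.loc) K.Z ≤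
      (IwasawaAlgebra.augIdealP p • ⊤ : Submodule (IwasawaAlgebra p) (IwasawaAlgebra p)) :=
    (Submodule.map_mono hZp).trans (by rw [Submodule.map_smul'']; exact Submodule.smul_mono le_rfl le_top)
  have htop : (IwasawaAlgebra.augIdealP p • ⊤ : Submodule (IwasawaAlgebra p) (IwasawaAlgebra p)) =
      IwasawaAlgebra.augIdealP p := by
    rw [Ideal.smul_eq_mul, Ideal.mul_top]
  have hsG' : s * G₁ ∈ IwasawaAlgebra.augIdealP p := by rw [← htop]; exact hsub hsG
  rcases (IwasawaAlgebra.isPrime_augIdealP_holds p).mem_or_mem hsG' with h | h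
  · exact hs h
  · exact hμ h

end Algebra

/-! ### §2 The `μ`-transfer at a multiplicative odd prime, without big image, from the CONTRAGREDIENT package XI′ -/

/-- **KATO `μ`-TRANSFER AT A MULTIPLICATIVE PRIME, NO BIG IMAGE — from the print-exact CONTRAGREDIENT package XI′.** The statement of this seat g6's
`mu_eq_zero_of_multFine` VERBATIM (for a globally minimal `W/ℚ`, an ODD multiplicative `p` with `E[p]` irreducible and `ρ̄_{E,p}` NOT onto, a
newform `f`, period ratio `ϖ`, the Mazur–Tate–Teitelbaum function `L` with `α = a_p = ±1`: ONE `p`-adic unit coefficient of `ϖ·L` forces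
`μ(X(E/ℚ_∞)) = 0` for EVERY cyclotomic γ-keyed Selmer dual datum `D`), with the input `hfine` (XI, γ-keyed) REPLACED by `hfine′`
(XI′ `Kato2004.exists_multDivisibilityInputs_fine_contra`, keyed on `SelmerDualData κ γ⁻¹`). Proof: twist `D` and a fine dual `Y` to the
contragredient structure (`exists_twist_selmerDualData_invol_of_mul_inv`, `exists_twist_fineSelmerDualData_invol`; `Λ`-finiteness transported),
apply XI′ to `(𝐇¹_γ, D′, Y′)`, run g6's argument (Wuthrich Cor. 18 ⟹ `G₁ ∈ Λ`; certificate ⟹ `G₁ ∉ (p)`; §6 (i) ⟹ a genuine Euler-system class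
`∉ p𝐇¹`; the reduction-free γ-keyed core ⟹ `Sel₀[p]` killed by `T^J` ⟹ `Y′.X/(p)` finite ⟹ `length_(p) Y′.X = 0` ⟹ `length_(p) D′.X = 0`),
then `length_(p) D.X = length_{ι⁻¹(p)} D.X = length_(p) D′.X` because `(p)` is ι-fixed (`comap_invol_eq_self_of_asIdeal_eq_augIdealP`) ⟹
`μ(D.X) = 0`. No functional equation enters (μ is ι-invariant). CONDITIONAL on XI′ and Cor. 18; nothing booked.
[cite: Kato2004Asterisque, Thm. 12.6 (p. 222), (14.9.3) (p. 240), §17.3 (p. 273), §17.13 (pp. 279–280)]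
[cite: Wuthrich2014, p. 391 and Cor. 18 (p. 398)] [cite: Greenberg1989, §0 pp. 101–102] [cite: Washington1997, §13.2] -/
theorem mu_eq_zero_of_multFineContra (hfine' : exists_multDivisibilityInputs_fine_contra)
    (h18 : Wuthrich2014.corollary18_padicLFunction_mem_iwasawaAlgebra_multiplicative) :
    ∀ (W : WeierstrassCurve ℚ) [W.IsElliptic] [W.IsGloballyMinimal] (p : ℕ) [Fact p.Prime]
      {N : ℕ} [NeZero N] (f : CuspForm (Gamma0 N) 2),
      p ≠ 2 → W.HasMultiplicativeReductionAtPrime p →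
      W.HasIrreducibleModPGaloisRep p → ¬ W.HasSurjectiveModNGaloisRep p → IsNewformOf W f →
      ∀ (ϖ : ℚ), (ϖ : ℝ) * W.realPeriodRat = plusPeriod f →
      ∀ (a : ℚ_[p]) (L : PowerSeries ℚ_[p]),
        (W.HasSplitMultiplicativeReductionAtPrime p → a = 1) →
        (¬ W.HasSplitMultiplicativeReductionAtPrime p → a = -1) →
        IsMultPAdicLFunctionOf f p a L →
        (∃ n : ℕ, ‖PowerSeries.coeff n (PowerSeries.C ((ϖ : ℚ) : ℚ_[p]) * L)‖ = 1) →
      ∀ (κ : ZpExtension ℚ p) (γ : absoluteGaloisGroup ℚ),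
        κ.IsCyclotomic → κ.IsTopGenerator γ → IsCyclotomicVariable p γ →
        ∀ D : W.SelmerDualData κ γ, D.mu = 0 := by
  intro W _ _ p _ N _ f hp2 hmult hirr hnsurj hf ϖ hϖ a L hsa hna hL hcert κ γ hκ hγ hγ' D
  haveI : ContinuousSMul ℤ_[p] (W.tateModule p) := TateModule.continuousSMul_padicInt
  haveI : Module.Free ℤ_[p] (W.tateModule p) := W.module_free_tateModule_holds p
  haveI : Module.Finite ℤ_[p] (W.tateModule p) := W.module_finite_tateModule_holds p
  -- the pinned modules: `𝐇¹_Γ(T_pW)` (γ-keyed) and a dual fine Selmer datum (γ-keyed)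
  obtain ⟨I⟩ := nonempty_iwasawaH1Data_holds W p κ γ hκ hγ
  obtain ⟨Y⟩ := W.nonempty_fineSelmerDualData κ hγ
  haveI : Module.Finite (IwasawaAlgebra p) D.X :=
    WeierstrassCurve.SelmerDualData.module_finite_of_isCyclotomic W κ hκ D hγ
  -- TWIST both duals to the CONTRAGREDIENT `Λ`-structure (`T ↦ (1+T)⁻¹ − 1`, i.e. `γ ↦ γ⁻¹`)
  obtain ⟨D', eD, heD, -, -, -, hlenD, hfinD⟩ :=
    SignedKatoOffTwo.IwasawaInvolution.exists_twist_selmerDualData_invol_of_mul_inv D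
  obtain ⟨Y', eY, heY, -, -, -, -⟩ :=
    SignedKatoOffTwo.IwasawaInvolution.exists_twist_fineSelmerDualData_invol (mul_inv_cancel γ) Y
  haveI : Module.Finite (IwasawaAlgebra p) D'.X := hfinD.mp inferInstance
  -- Kato's PRINT-EXACT package at the multiplicative prime for `(𝐇¹_γ, D′, Y′)`, with fine quotient, span and image clauses
  obtain ⟨K, π, hloc0, hπs, hπ, hZ, himg⟩ := hfine' W p f κ γ hp2 hmult hκ hγ hγ' hf a L hsa hna hL I D' Y'
  haveI : Module.Finite (IwasawaAlgebra p) Y'.X := Module.Finite.of_surjective π hπs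
  -- `ϖ·L ∈ Λ` (Wuthrich 2014 Cor. 18) and the certificate: `G₁ ∉ (p)`
  obtain ⟨G₁, hG₁⟩ : ∃ G₁ : IwasawaAlgebra p,
      iwasawaToPowerSeries p G₁ = PowerSeries.C ((ϖ : ℚ) : ℚ_[p]) * L := by
    obtain ⟨hns, hs⟩ := h18 W p hp2 hmult hf ϖ hϖ
    by_cases hsplit : W.HasSplitMultiplicativeReductionAtPrime p
    · have ha : a = 1 := hsa hsplit
      subst ha
      exact hs hsplit L ((isMultPAdicLFunctionOf_one_iff L).mp hL)
    · have ha : a = -1 := hna hsplit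
      subst ha
      exact hns hsplit L hL
  have hμL : G₁ ∉ IwasawaAlgebra.augIdealP p := not_mem_augIdealP_of_norm_coeff_eq_one hG₁ hcert
  let 𝔭 : PrimeSpectrum (IwasawaAlgebra p) :=
    ⟨IwasawaAlgebra.augIdealP p, IwasawaAlgebra.isPrime_augIdealP_holds p⟩
  have himg𝔭 : ∃ s : IwasawaAlgebra p, s ∉ IwasawaAlgebra.augIdealP p ∧
      s * G₁ ∈ Submodule.map (K.col ∘ₗ K.loc) K.Z := by
    obtain ⟨s, hs, hsG, -⟩ :=
      himg hirr G₁ ϖ hϖ hG₁ 𝔭 (by exact IwasawaAlgebra.height_augIdealP_holds p)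
    exact ⟨s, hs, hsG⟩
  -- §6 (i): some GENUINE Euler-system class is not divisible by `p`
  obtain ⟨s, hs, hsp⟩ := exists_isEulerSystemClass_not_mem_of_multContra K hZ hμL himg𝔭
  -- the reduction-free γ-keyed core: a power of `T = γ − 1` kills the `E[p]`-lifts of `Sel₀`
  obtain ⟨J, hJ⟩ := CoreAssembly.coreOdd_anyReduction_holds W p κ γ I hp2 hirr
    (by exact_mod_cast hnsurj) hκ hγ ⟨s, hs, hsp⟩
  -- `Sel₀[p]` finite ⟹ `Y′.X/(p)` finite — key-free
  haveI : Finite (Y'.X ⧸ (IwasawaAlgebra.augIdealP p • (⊤ : Submodule (IwasawaAlgebra p) Y'.X))) :=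
    Y'.finite_quotient_augIdealP_of_finite_pTorsion
      (W.finite_fineSelmerInfty_pTorsion_of_forall_iterate_eq_zero κ hγ hJ)
  -- bookkeeping at `𝔭 = (p)`: `length Y′_𝔭 = 0 ⟹ length D′_𝔭 = 0`
  have hY0 : Module.lengthAt (IwasawaAlgebra p) Y'.X 𝔭 = 0 :=
    Summit.BirchSwinnertonDyer.BirchSwinnertonDyer.Rank1Residual.KatoMuSkeleton.lengthAt_eq_zero_of_finite_quotient_p
      (M := Y'.X) 𝔭 rfl
  have hX0' : Module.lengthAt (IwasawaAlgebra p) D'.X 𝔭 = 0 :=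
    le_antisymm ((lengthAt_X_le_of_multContra K hloc0 𝔭 hμL himg𝔭 π hπ).trans hY0.le) bot_le
  -- back to the γ-datum: `(p)` is a fixed point of `ι` on `Spec Λ`
  have hX0 : Module.lengthAt (IwasawaAlgebra p) D.X 𝔭 = 0 := by
    rw [← IwasawaAlgebra.comap_invol_eq_self_of_asIdeal_eq_augIdealP p 𝔭 rfl, hlenD 𝔭]
    exact hX0'
  change muInvariant p D.X = 0
  rw [muInvariant_eq_toNat_lengthAt p D.X 𝔭 rfl, hX0]
  rfl

end Summit.BirchSwinnertonDyer.Rank1Residual.X11b.MultMu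

namespace Summit.BirchSwinnertonDyer.Rank1Residual.X11b.MultMu

/-! ### §3 (appended) The corner consumers of the μ-road re-keyed on XI′ — `…_contra` siblings of `…TwinMuOfLane` §1–§2 -/

/-- **`X11a.MuAnZeroAt W p ⟹ μ(X(E/ℚ_∞)) = 0`** at an ODD multiplicative prime with `E[p]` irreducible and `ρ̄` NOT onto — `…TwinMuOfLane`'s
`mu_eq_zero_of_muAnZeroAt` VERBATIM with the Kato input XI replaced by the print-exact XI′ (`hfine′`, through `mu_eq_zero_of_multFineContra`).
[cite: Kato2004Asterisque, Thm. 12.6 (p. 222) and §17.13 (pp. 279–280)] [cite: Wuthrich2014, Cor. 18 (p. 398)] [cite: GreenbergLNM1716, §1 Conj. 1.11 (shape)] -/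
theorem mu_eq_zero_of_muAnZeroAt_contra (hfine' : exists_multDivisibilityInputs_fine_contra)
    (h18 : Wuthrich2014.corollary18_padicLFunction_mem_iwasawaAlgebra_multiplicative)
    (hpar : nonempty_modularParametrizationData)
    (W : WeierstrassCurve ℚ) [W.IsElliptic] [W.IsGloballyMinimal] (p : ℕ) [Fact p.Prime]
    (hp : p ≠ 2) (hmult : W.HasMultiplicativeReductionAtPrime p) (hirr : W.HasIrreducibleModPGaloisRep p)
    (hnsurj : ¬ W.HasSurjectiveModNGaloisRep p) (hA : X11a.MuAnZeroAt W p) :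
    ∀ (κ : ZpExtension ℚ p) (γ : absoluteGaloisGroup ℚ),
      κ.IsCyclotomic → κ.IsTopGenerator γ → IsCyclotomicVariable p γ →
      ∀ D : W.SelmerDualData κ γ, D.mu = 0 := by
  intro κ γ hκ hγ hγ' D
  haveI : NeZero (W.conductorNorm ℤ) := ⟨(W.conductorNorm_pos_holds).ne'⟩
  obtain ⟨Dm⟩ := hpar W
  obtain ⟨ϖ, -, hϖ, -⟩ := Dm.exists_rat_mul_realPeriodRat_eq_plusPeriod
  obtain ⟨hAns, hAs⟩ := hA Dm.f Dm.isNewformOf ϖ hϖ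
  by_cases hsplit : W.HasSplitMultiplicativeReductionAtPrime p
  · obtain ⟨L, hL⟩ := exists_isSplitMultPAdicLFunctionOf hsplit Dm.isNewformOf
    exact mu_eq_zero_of_multFineContra hfine' h18 W p Dm.f hp hmult hirr hnsurj Dm.isNewformOf ϖ hϖ 1 L
      (fun _ => rfl) (fun hns => absurd hsplit hns) ((isMultPAdicLFunctionOf_one_iff L).mpr hL)
      (hAs hsplit L hL) κ γ hκ hγ hγ' D
  · obtain ⟨L, hL⟩ := exists_isMultPAdicLFunctionOf_neg_one_of_nonsplit Dm.isNewformOf hmult hsplit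
    exact mu_eq_zero_of_multFineContra hfine' h18 W p Dm.f hp hmult hirr hnsurj Dm.isNewformOf ϖ hϖ (-1) L
      (fun hs => absurd hs hsplit) (fun _ => rfl) hL (hAns hsplit L hL) κ γ hκ hγ hγ' D

end Summit.BirchSwinnertonDyer.Rank1Residual.X11b.MultMu

namespace Summit.BirchSwinnertonDyer.BirchSwinnertonDyer.Theorems

open Summit.BirchSwinnertonDyer.Rank1Residual Summit.BirchSwinnertonDyer.Rank1Residual.X11b

/-- **`NonSurjCornerTwinMu` (Greenberg's `μ = 0` at the non-surjective X11a leaf twins, BY NAME) from the X11a LANE CERTIFICATE at every such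
twin**, modulo XI′ (print-exact), Wuthrich Cor. 18 and the parametrisation supply — `twinMu_of_laneCertificates` with `hfine ↦ hfine′`.
[cite: GreenbergLNM1716, §1 Conj. 1.11 (p. 61)] [cite: Kato2004Asterisque, §17.13 (pp. 279–280)] [cite: Wuthrich2014, Cor. 18 (p. 398)] -/
theorem twinMu_of_laneCertificates_contra (hfine' : Kato2004.exists_multDivisibilityInputs_fine_contra)
    (h18 : Wuthrich2014.corollary18_padicLFunction_mem_iwasawaAlgebra_multiplicative)
    (hpar : nonempty_modularParametrizationData)
    (hLane : ∀ (Wd : WeierstrassCurve ℚ) [Wd.IsElliptic] [Wd.IsGloballyMinimal] (p : ℕ) [Fact p.Prime],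
      ClassX11a Wd p → ¬ Surj Wd p → (p = 5 ∨ p = 7) → p ∣ padicValInt p Wd.minimalDiscriminantInt →
      X11a.MuAnZeroAt Wd p) :
    NonSurjCornerTwinMu := by
  intro Wd _ _ p _ hXa hns h57 hv κ γ hκ hγ hγ' D
  exact MultMu.mu_eq_zero_of_muAnZeroAt_contra hfine' h18 hpar Wd p hXa.2.1 hXa.2.2.1 hXa.2.2.2.1 hns
    (hLane Wd p hXa hns h57 hv) κ γ hκ hγ hγ' D

/-- **The literal child from the analytic child, on the print-exact package**: `NonSurjCornerTwinMuAn → NonSurjCornerTwinMu` modulo XI′, Wuthrich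
Cor. 18 and the parametrisation supply — `twinMu_of_twinMuAn` with `hfine ↦ hfine′` (the γ-keyed theorem keeps its name; consumers re-key by
swapping one hypothesis constant). CONDITIONAL; nothing booked. [cite: GreenbergLNM1716, §1 Conj. 1.11 (p. 61)] [cite: Kato2004Asterisque, §17.13 (pp. 279–280)] -/
theorem twinMu_of_twinMuAn_contra (hfine' : Kato2004.exists_multDivisibilityInputs_fine_contra)
    (h18 : Wuthrich2014.corollary18_padicLFunction_mem_iwasawaAlgebra_multiplicative)
    (hpar : nonempty_modularParametrizationData) (hμ : NonSurjCornerTwinMuAn) : NonSurjCornerTwinMu :=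
  twinMu_of_laneCertificates_contra hfine' h18 hpar (laneCertificates_of_twinMuAn hμ)

end Summit.BirchSwinnertonDyer.BirchSwinnertonDyer.Theorems

end
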